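import Summits.QuantumAdvantage.QuantumAdvantage.Theorems.LinnikCubicClassGroupsDegreeOnePrimesEscapeRayClassPi
import Summits.QuantumAdvantage.QuantumAdvantage.Theorems.LinnikCubicClassGroupsDegreeOnePrimesEscapeRayClassCounting
import Literature.NumberTheory.LFunctions.LittlewoodOscillationInputsPiProofs
import Literature.NumberTheory.LFunctions.LogIntegralOffsetEquivalentProofs
import HarnessLib

/-!
# Landau's prime ideal theorem for the cosets of a congruence class group, asymptotic form: `π_τ(x) ∼ Li(x)/|G|`
# (all residue degrees, and degree one) — the fixed-datum limit of the cell's Linnik-range dichotomy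

Topic `Summits/QuantumAdvantage/QuantumAdvantage/Theorems`, cell B2b-1 (linnik-cubic), PART A (gen 39); helper toward the crux
`DegreeOnePrimesEscape` (stmt-QuantumAdvantage-11543) of route `LinnikCubicClassGroups`.  HONEST FRAMING: the value of this file is a
THEOREM (kernel-checked, unconditional) — NOT summit progress (the route still rests on the hypothesis-type target `PureCubicClassNumberHard`).

For a number field `K` of degree `n > 1` and an abelian Frobenius datum `f : 𝔭 ↦ f 𝔭 ∈ G` killing the narrow ray `mod 𝔪 ≠ 0` whose
non-trivial characters are non-principal off `𝔪`, `|G| ≤ Q_𝔪⁴` (a congruence class group; e.g. ray classes, ring classes), the cell's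
`fiberPrimeCount_relative` (gen 23) gives, for every `ε > 0` and `x ≥ Q_𝔪^{L(ε)}`, either `π_τ(x) = (1 ± ε) Li(x)/|G|` or — when a real
character `ψ₁` has a real zero `β₁ < 1` — `π_τ(x) = (1 ± ε)(Li(x) − ψ₁(τ) Li(x^{β₁}))/|G|`.  For a FIXED datum `Li(x^{β₁}) = o(Li(x))`, whence:
* `tendsto_offsetLogIntegral_rpow_div` (`Li(x^β)/Li(x) → 0`, `β < 1`), `tendsto_sqrt_div_offsetLogIntegral` (`√x/Li(x) → 0`);
* **`tendsto_ncard_fiber_div_offsetLogIntegral`** — `π_τ(x)/Li(x) → 1/|G|` for every coset `τ` (all residue degrees counted);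
* **`tendsto_ncard_fiber_degOne_div_offsetLogIntegral`** — the same for the degree-one primes of the coset (Landau 1918).
Consumed by `…BinaryFormPNT.lean` (the prime number theorem for a binary quadratic form).

## References
* E. Landau, *Über Ideale und Primideale in Idealklassen*, Math. Z. 2 (1918) 52–154, §1. [Landau1918Idealklassen]
* J. Thorner, A. Zaman, Algebra Number Theory 11 (2017), Thm. 3.1 (the Linnik-range input). [ThornerZaman2017]
-/

noncomputable section

open Complex Real Set Filter Topology NumberField IsDedekindDomain Module Asymptotics
open scoped NumberField nonZeroDivisors

namespace Summit.QuantumAdvantage.QuantumAdvantage.Theorems.DegreeOnePrimesEscape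

open Literature.NumberTheory.LFunctions Literature.NumberTheory.LFunctions.NumberField
  Literature.NumberTheory.LFunctions.AbelianDensity Literature.NumberTheory.GaloisRepresentations
open scoped Classical

/-! ### `Li(x^β) = o(Li(x))` for `β < 1`, and `√x = o(Li(x))` -/

/-- `Li(x^β)/Li(x) → 0` for `0 < β < 1` (`Li(x^β) ≤ 2x^β`, `Li(x) ≥ x/(2 log x)`, `log x = o(x^{1−β})`). -/
theorem tendsto_offsetLogIntegral_rpow_div {β : ℝ} (hβ0 : 0 < β) (hβ1 : β < 1) :
    Tendsto (fun x : ℝ ↦ offsetLogIntegral (x ^ β) / offsetLogIntegral x) atTop (𝓝 0) := by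
  -- the majorant `4 log x / x^{1-β} → 0`
  have hmaj : Tendsto (fun x : ℝ ↦ 4 * (Real.log x / x ^ (1 - β))) atTop (𝓝 0) := by
    have h := (isLittleO_log_rpow_atTop (by linarith : 0 < 1 - β)).tendsto_div_nhds_zero
    simpa using h.const_mul 4
  have hx0 : ∀ᶠ x : ℝ in atTop, 256 ≤ x := eventually_ge_atTop _
  have hxβ : ∀ᶠ x : ℝ in atTop, 2 ≤ x ^ β := by
    have ht : Tendsto (fun x : ℝ ↦ x ^ β) atTop atTop := tendsto_rpow_atTop hβ0
    exact ht.eventually_ge_atTop 2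
  refine tendsto_of_tendsto_of_tendsto_of_le_of_le' tendsto_const_nhds hmaj ?_ ?_
  · filter_upwards [hx0, hxβ] with x hx hxb
    have hLi : 0 < offsetLogIntegral x := lt_of_lt_of_le (by
      have : 0 < x / (2 * Real.log x) := div_pos (by linarith) (by have := Real.log_pos (by linarith : (1:ℝ) < x); positivity)
      exact this) (div_two_mul_log_le_offsetLogIntegral hx)
    exact div_nonneg (PiOmega.offsetLogIntegral_bounds hxb).1 hLi.le
  · filter_upwards [hx0, hxβ] with x hx hxb
    have hlog : 0 < Real.log x := Real.log_pos (by linarith)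
    have hxpos : 0 < x := by linarith
    have hLi := div_two_mul_log_le_offsetLogIntegral hx
    have hLipos : 0 < offsetLogIntegral x := lt_of_lt_of_le (div_pos hxpos (by positivity)) hLi
    have hnum := (PiOmega.offsetLogIntegral_bounds hxb).2
    have h1b : x ^ (1 - β) = x / x ^ β := by rw [Real.rpow_sub hxpos, Real.rpow_one]
    have hxb0 : 0 < x ^ β := by positivity
    calc offsetLogIntegral (x ^ β) / offsetLogIntegral x
        ≤ (2 * x ^ β) / (x / (2 * Real.log x)) := by
          exact div_le_div₀ (by positivity) hnum (div_pos hxpos (by positivity)) hLi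
      _ = 4 * (Real.log x / x ^ (1 - β)) := by
          rw [h1b]
          field_simp
          ring

/-- `√x / Li(x) → 0`. -/
theorem tendsto_sqrt_div_offsetLogIntegral :
    Tendsto (fun x : ℝ ↦ Real.sqrt x / offsetLogIntegral x) atTop (𝓝 0) := by
  have hmaj : Tendsto (fun x : ℝ ↦ 2 * (Real.log x / x ^ (1 / 2 : ℝ))) atTop (𝓝 0) := by
    have h := (isLittleO_log_rpow_atTop (by norm_num : (0 : ℝ) < 1 / 2)).tendsto_div_nhds_zero
    simpa using h.const_mul 2
  have hx0 : ∀ᶠ x : ℝ in atTop, 256 ≤ x := eventually_ge_atTop _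
  refine tendsto_of_tendsto_of_tendsto_of_le_of_le' tendsto_const_nhds hmaj ?_ ?_
  · filter_upwards [hx0] with x hx
    have hLi : 0 < offsetLogIntegral x := lt_of_lt_of_le
      (div_pos (by linarith) (by have := Real.log_pos (by linarith : (1:ℝ) < x); positivity))
      (div_two_mul_log_le_offsetLogIntegral hx)
    exact div_nonneg (Real.sqrt_nonneg x) hLi.le
  · filter_upwards [hx0] with x hx
    have hlog : 0 < Real.log x := Real.log_pos (by linarith)
    have hxpos : 0 < x := by linarith
    have hLi := div_two_mul_log_le_offsetLogIntegral hx
    have hs0 : 0 < Real.sqrt x := Real.sqrt_pos.mpr hxpos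
    have hx' : Real.sqrt x * Real.sqrt x = x := Real.mul_self_sqrt hxpos.le
    calc Real.sqrt x / offsetLogIntegral x ≤ Real.sqrt x / (x / (2 * Real.log x)) :=
          div_le_div_of_nonneg_left (Real.sqrt_nonneg x) (div_pos hxpos (by positivity)) hLi
      _ = 2 * (Real.log x / x ^ (1 / 2 : ℝ)) := by
          rw [← Real.sqrt_eq_rpow, div_div_eq_mul_div, div_eq_iff hxpos.ne']
          field_simp
          nlinarith [hx', hlog, hs0]

/-! ### Landau's prime ideal theorem for the cosets of a congruence class group (asymptotic form) -/

/-- **`π_τ(x) ∼ Li(x)/|G|` for every coset `τ`** of a congruence class group (abelian Frobenius datum killing the narrow ray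
`mod 𝔪 ≠ 0`, non-trivial characters non-principal off `𝔪`, `|G| ≤ Q_𝔪⁴`), all residue degrees counted: the fixed-datum limit of the
cell's Linnik-range dichotomy `fiberPrimeCount_relative` (`Li(x^{β₁}) = o(Li x)` disposes of the exceptional term).
[cite: Landau1918Idealklassen, §1 Satz] -/
theorem tendsto_ncard_fiber_div_offsetLogIntegral (n : ℕ) (hn : 1 < n) (K : Type) [Field K] [NumberField K]
    (hKn : finrank ℚ K = n) (G : Type) [CommGroup G] [Finite G] (𝔪 : Ideal (𝓞 K)) (f : HeightOneSpectrum (𝓞 K) → G)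
    (h𝔪 : 𝔪 ≠ ⊥) (hray : ArtinKillsRay 𝔪 f)
    (hsep : ∀ χ : AddChar (Additive G) ℂ, χ ≠ 0 → ∃ v : HeightOneSpectrum (𝓞 K), ¬ 𝔪 ≤ v.asIdeal ∧ χ (Additive.ofMul (f v)) ≠ 1)
    (hG : (Nat.card G : ℝ) ≤ rayCondQ K 𝔪 ^ (4 : ℕ)) (τ : G) :
    Tendsto (fun x : ℝ ↦ (({v : HeightOneSpectrum (𝓞 K) | ¬ 𝔪 ≤ v.asIdeal ∧ f v = τ ∧
        (Ideal.absNorm v.asIdeal : ℝ) ≤ x}.ncard : ℕ) : ℝ) / offsetLogIntegral x) atTop (𝓝 (1 / Nat.card G)) := by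
  rw [Metric.tendsto_nhds]
  intro ε hε
  set h : ℝ := (Nat.card G : ℝ) with hh
  have hh1 : (1 : ℝ) ≤ h := by rw [hh]; exact Nat.one_le_cast.mpr (Nat.card_pos (α := G))
  have hh0 : 0 < h := by linarith
  set δ : ℝ := min (ε / 4) 1 with hδ
  have hε4 : 0 < δ := lt_min (by positivity) one_pos
  have hδε : δ ≤ ε / 4 := min_le_left _ _
  have hδ1 : δ ≤ 1 := min_le_right _ _
  obtain ⟨L, c, hL1, hc, hcn, hmain⟩ := fiberPrimeCount_relative n hn hε4
  have hQ12 : (12 : ℝ) ≤ rayCondQ K 𝔪 := twelve_le_rayCondQ (by rw [hKn]; exact hn) h𝔪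
  have hxL : ∀ᶠ x : ℝ in atTop, rayCondQ K 𝔪 ^ L ≤ x := eventually_ge_atTop _
  have hx256 : ∀ᶠ x : ℝ in atTop, 256 ≤ x := eventually_ge_atTop _
  set cnt : ℝ → ℝ := fun x ↦ (({v : HeightOneSpectrum (𝓞 K) | ¬ 𝔪 ≤ v.asIdeal ∧ f v = τ ∧
      (Ideal.absNorm v.asIdeal : ℝ) ≤ x}.ncard : ℕ) : ℝ) with hcnt
  have hLipos : ∀ x : ℝ, 256 ≤ x → 0 < offsetLogIntegral x := fun x hx ↦
    lt_of_lt_of_le (div_pos (by linarith) (by have := Real.log_pos (by linarith : (1:ℝ) < x); positivity))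
      (div_two_mul_log_le_offsetLogIntegral hx)
  rcases hmain K hKn G 𝔪 f h𝔪 hray hsep hG with hgood | ⟨ψ₁, β₁, -, hβlow, hβ1, -, hexc⟩
  · filter_upwards [hxL, hx256] with x hx hx2
    have hb := hgood x hx τ
    have hLi := hLipos x hx2
    rw [Real.dist_eq]
    have : cnt x / offsetLogIntegral x - 1 / h = (cnt x - offsetLogIntegral x / h) / offsetLogIntegral x := by
      field_simp
    rw [show (({v : HeightOneSpectrum (𝓞 K) | ¬ 𝔪 ≤ v.asIdeal ∧ f v = τ ∧ (Ideal.absNorm v.asIdeal : ℝ) ≤ x}.ncard : ℕ) : ℝ)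
        = cnt x from rfl, this, abs_div, abs_of_pos hLi, div_lt_iff₀ hLi]
    calc |cnt x - offsetLogIntegral x / h| ≤ δ * offsetLogIntegral x / h := hb
      _ ≤ δ * offsetLogIntegral x := by
          rw [mul_div_assoc]; exact mul_le_mul_of_nonneg_left (div_le_self hLi.le hh1) hε4.le
      _ < ε * offsetLogIntegral x := by nlinarith
  · -- the exceptional branch: `β₁ > 1 − c/(…) > 0`
    have hβ0 : 0 < β₁ := by
      have hn2 : (2 : ℝ) ≤ n := by exact_mod_cast hn
      have hc1 : c ≤ 1 := by
        refine hcn.trans ?_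
        rw [div_le_one (by positivity)]
        nlinarith
      have hlog4 : (1 : ℝ) ≤ Real.log 4 := by
        have := Real.add_one_le_exp (1 : ℝ)
        have he : Real.exp 1 ≤ 4 := by
          have := Real.exp_one_lt_d9; linarith
        calc (1 : ℝ) = Real.log (Real.exp 1) := (Real.log_exp 1).symm
          _ ≤ Real.log 4 := Real.log_le_log (Real.exp_pos 1) he
      have hlog0 : 0 ≤ Real.log (((discr K).natAbs : ℝ) * ((Ideal.absNorm 𝔪 : ℕ) : ℝ)) := by
        apply Real.log_nonneg
        have h1 : (1 : ℝ) ≤ ((discr K).natAbs : ℝ) := by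
          exact_mod_cast Nat.one_le_iff_ne_zero.mpr (Int.natAbs_ne_zero.mpr (NumberField.discr_ne_zero K))
        have h2 : (1 : ℝ) ≤ ((Ideal.absNorm 𝔪 : ℕ) : ℝ) := by
          exact_mod_cast Nat.one_le_iff_ne_zero.mpr (by rw [Ne, Ideal.absNorm_eq_zero_iff]; exact h𝔪)
        nlinarith
      have hX : (1 : ℝ) ≤ Real.log (((discr K).natAbs : ℝ) * ((Ideal.absNorm 𝔪 : ℕ) : ℝ)) + Real.log 4 := by linarith
      have hcX : c / (Real.log (((discr K).natAbs : ℝ) * ((Ideal.absNorm 𝔪 : ℕ) : ℝ)) + Real.log 4) ≤ c :=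
        div_le_self hc.le hX
      linarith
    have hr := (tendsto_offsetLogIntegral_rpow_div hβ0 hβ1)
    rw [Metric.tendsto_nhds] at hr
    have hxβ2 : ∀ᶠ x : ℝ in atTop, 2 ≤ x ^ β₁ := (tendsto_rpow_atTop hβ0).eventually_ge_atTop 2
    filter_upwards [hxL, hx256, hr δ hε4, hxβ2] with x hx hx2 hrx hxb
    obtain ⟨hMpos, hb⟩ := hexc x hx τ
    set M : ℝ := offsetLogIntegral x - (ψ₁ (Additive.ofMul τ)).re * offsetLogIntegral (x ^ β₁) with hM
    have hLi := hLipos x hx2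
    have hLiβ : 0 ≤ offsetLogIntegral (x ^ β₁) := (PiOmega.offsetLogIntegral_bounds hxb).1
    rw [Real.dist_eq, sub_zero, abs_of_nonneg (div_nonneg hLiβ hLi.le)] at hrx
    set r : ℝ := offsetLogIntegral (x ^ β₁) / offsetLogIntegral x with hrdef
    have hψ : |(ψ₁ (Additive.ofMul τ)).re| ≤ 1 := by
      have h1 := Complex.abs_re_le_norm (ψ₁ (Additive.ofMul τ))
      rwa [AddChar.norm_apply] at h1
    -- `|M − Li| ≤ Li(x^β₁)`
    have hMLi : |M - offsetLogIntegral x| ≤ offsetLogIntegral (x ^ β₁) := by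
      have : M - offsetLogIntegral x = -((ψ₁ (Additive.ofMul τ)).re * offsetLogIntegral (x ^ β₁)) := by
        rw [hM]; ring
      rw [this, abs_neg, abs_mul, abs_of_nonneg hLiβ]
      calc |(ψ₁ (Additive.ofMul τ)).re| * offsetLogIntegral (x ^ β₁) ≤ 1 * offsetLogIntegral (x ^ β₁) :=
            mul_le_mul_of_nonneg_right hψ hLiβ
        _ = offsetLogIntegral (x ^ β₁) := one_mul _
    rw [Real.dist_eq]
    have hLine : cnt x / offsetLogIntegral x - 1 / h =
        ((cnt x - M / h) + (M - offsetLogIntegral x) / h) / offsetLogIntegral x := by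
      field_simp; ring
    rw [show (({v : HeightOneSpectrum (𝓞 K) | ¬ 𝔪 ≤ v.asIdeal ∧ f v = τ ∧ (Ideal.absNorm v.asIdeal : ℝ) ≤ x}.ncard : ℕ) : ℝ)
        = cnt x from rfl, hLine, abs_div, abs_of_pos hLi, div_lt_iff₀ hLi]
    have hA : |cnt x - M / h| ≤ δ * M / h := hb
    have hB : |(M - offsetLogIntegral x) / h| ≤ offsetLogIntegral (x ^ β₁) / h := by
      rw [abs_div, abs_of_pos hh0]
      exact div_le_div_of_nonneg_right hMLi hh0.le
    have hA' : δ * M / h ≤ δ * M := by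
      rw [mul_div_assoc]; exact mul_le_mul_of_nonneg_left (div_le_self hMpos.le hh1) hε4.le
    have hB' : offsetLogIntegral (x ^ β₁) / h ≤ offsetLogIntegral (x ^ β₁) := div_le_self hLiβ hh1
    have hMle : M ≤ offsetLogIntegral x + offsetLogIntegral (x ^ β₁) := by
      have := (abs_sub_le_iff.1 hMLi).1; linarith
    have hrLi : offsetLogIntegral (x ^ β₁) = r * offsetLogIntegral x := by
      rw [hrdef, div_mul_cancel₀ _ hLi.ne']
    have hr1 : r < δ := hrx
    have hr0 : 0 ≤ r := by rw [hrdef]; exact div_nonneg hLiβ hLi.le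
    calc |cnt x - M / h + (M - offsetLogIntegral x) / h|
        ≤ |cnt x - M / h| + |(M - offsetLogIntegral x) / h| := abs_add_le _ _
      _ ≤ δ * M + offsetLogIntegral (x ^ β₁) := by linarith
      _ ≤ δ * (offsetLogIntegral x + offsetLogIntegral (x ^ β₁)) + offsetLogIntegral (x ^ β₁) := by
          nlinarith
      _ = (δ * (1 + r) + r) * offsetLogIntegral x := by rw [hrLi]; ring
      _ < ε * offsetLogIntegral x := by
          apply mul_lt_mul_of_pos_right _ hLi
          nlinarith

/-- The primes of `K` of norm `≤ x` form a finite set. -/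
theorem finite_setOf_absNorm_le (K : Type) [Field K] [NumberField K] (x : ℝ) :
    {v : HeightOneSpectrum (𝓞 K) | (Ideal.absNorm v.asIdeal : ℝ) ≤ x}.Finite := by
  have hfin := Ideal.finite_setOf_absNorm_le (S := 𝓞 K) ⌊x⌋₊
  have hinj : Set.InjOn (fun v : HeightOneSpectrum (𝓞 K) ↦ v.asIdeal)
      ((fun v : HeightOneSpectrum (𝓞 K) ↦ v.asIdeal) ⁻¹' {I : Ideal (𝓞 K) | Ideal.absNorm I ≤ ⌊x⌋₊}) :=
    fun v _ w _ h ↦ HeightOneSpectrum.ext h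
  refine (hfin.preimage hinj).subset fun v hv ↦ ?_
  simp only [Set.mem_preimage, Set.mem_setOf_eq] at hv ⊢
  by_cases hx : 0 ≤ x
  · exact Nat.le_floor hv
  · exfalso
    have : (0 : ℝ) ≤ (Ideal.absNorm v.asIdeal : ℝ) := Nat.cast_nonneg _
    linarith

/-- **`π_τ(x) ∼ Li(x)/|G|` for the DEGREE-ONE primes of a coset** (the primes of residue degree `≥ 2` number `≤ n(√x + 1)`,
`ncard_coset_sub_degOne_le`). [cite: Landau1918Idealklassen, §1 Satz] -/
theorem tendsto_ncard_fiber_degOne_div_offsetLogIntegral (n : ℕ) (hn : 1 < n) (K : Type) [Field K] [NumberField K]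
    (hKn : finrank ℚ K = n) (G : Type) [CommGroup G] [Finite G] (𝔪 : Ideal (𝓞 K)) (f : HeightOneSpectrum (𝓞 K) → G)
    (h𝔪 : 𝔪 ≠ ⊥) (hray : ArtinKillsRay 𝔪 f)
    (hsep : ∀ χ : AddChar (Additive G) ℂ, χ ≠ 0 → ∃ v : HeightOneSpectrum (𝓞 K), ¬ 𝔪 ≤ v.asIdeal ∧ χ (Additive.ofMul (f v)) ≠ 1)
    (hG : (Nat.card G : ℝ) ≤ rayCondQ K 𝔪 ^ (4 : ℕ)) (τ : G) :
    Tendsto (fun x : ℝ ↦ (({v : HeightOneSpectrum (𝓞 K) | ¬ 𝔪 ≤ v.asIdeal ∧ f v = τ ∧ (Ideal.absNorm v.asIdeal).Prime ∧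
        (Ideal.absNorm v.asIdeal : ℝ) ≤ x}.ncard : ℕ) : ℝ) / offsetLogIntegral x) atTop (𝓝 (1 / Nat.card G)) := by
  have hcnt := tendsto_ncard_fiber_div_offsetLogIntegral n hn K hKn G 𝔪 f h𝔪 hray hsep hG τ
  have hsq := tendsto_sqrt_div_offsetLogIntegral
  have hLi := tendsto_offsetLogIntegral_atTop
  -- lower function: `(cnt − n(√x+1))/Li → 1/|G|`
  have hlow : Tendsto (fun x : ℝ ↦ (({v : HeightOneSpectrum (𝓞 K) | ¬ 𝔪 ≤ v.asIdeal ∧ f v = τ ∧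
        (Ideal.absNorm v.asIdeal : ℝ) ≤ x}.ncard : ℕ) : ℝ) / offsetLogIntegral x -
        (n : ℝ) * (Real.sqrt x / offsetLogIntegral x + 1 / offsetLogIntegral x)) atTop (𝓝 (1 / Nat.card G)) := by
    have h1 : Tendsto (fun x : ℝ ↦ 1 / offsetLogIntegral x) atTop (𝓝 0) :=
      (hLi.inv_tendsto_atTop).congr' (Eventually.of_forall fun x => by simp [one_div])
    have h2 := (hsq.add h1).const_mul (n : ℝ)
    simp only [add_zero, mul_zero] at h2
    simpa using hcnt.sub h2
  refine tendsto_of_tendsto_of_tendsto_of_le_of_le' hlow hcnt ?_ ?_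
  · filter_upwards [eventually_ge_atTop (256 : ℝ)] with x hx
    have hLipos : 0 < offsetLogIntegral x := lt_of_lt_of_le
      (div_pos (by linarith) (by have := Real.log_pos (by linarith : (1:ℝ) < x); positivity))
      (div_two_mul_log_le_offsetLogIntegral hx)
    have h := ncard_coset_sub_degOne_le (𝔪 := 𝔪) (f := f) τ (show (0:ℝ) ≤ x by linarith)
    rw [hKn] at h
    have e : (({v : HeightOneSpectrum (𝓞 K) | ¬ 𝔪 ≤ v.asIdeal ∧ f v = τ ∧
        (Ideal.absNorm v.asIdeal : ℝ) ≤ x}.ncard : ℕ) : ℝ) / offsetLogIntegral x -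
        (n : ℝ) * (Real.sqrt x / offsetLogIntegral x + 1 / offsetLogIntegral x) =
        ((({v : HeightOneSpectrum (𝓞 K) | ¬ 𝔪 ≤ v.asIdeal ∧ f v = τ ∧
        (Ideal.absNorm v.asIdeal : ℝ) ≤ x}.ncard : ℕ) : ℝ) - (n : ℝ) * (Real.sqrt x + 1)) / offsetLogIntegral x := by
      field_simp
    rw [e]
    exact div_le_div_of_nonneg_right (by linarith [h]) hLipos.le
  · filter_upwards [eventually_ge_atTop (256 : ℝ)] with x hx
    have hLipos : 0 < offsetLogIntegral x := lt_of_lt_of_le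
      (div_pos (by linarith) (by have := Real.log_pos (by linarith : (1:ℝ) < x); positivity))
      (div_two_mul_log_le_offsetLogIntegral hx)
    refine div_le_div_of_nonneg_right ?_ hLipos.le
    have hsub : {v : HeightOneSpectrum (𝓞 K) | ¬ 𝔪 ≤ v.asIdeal ∧ f v = τ ∧ (Ideal.absNorm v.asIdeal).Prime ∧
        (Ideal.absNorm v.asIdeal : ℝ) ≤ x} ⊆
        {v : HeightOneSpectrum (𝓞 K) | ¬ 𝔪 ≤ v.asIdeal ∧ f v = τ ∧ (Ideal.absNorm v.asIdeal : ℝ) ≤ x} :=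
      fun v hv ↦ ⟨hv.1, hv.2.1, hv.2.2.2⟩
    have hfin : {v : HeightOneSpectrum (𝓞 K) | ¬ 𝔪 ≤ v.asIdeal ∧ f v = τ ∧ (Ideal.absNorm v.asIdeal : ℝ) ≤ x}.Finite :=
      (finite_setOf_absNorm_le K x).subset fun v hv ↦ hv.2.2
    exact_mod_cast Set.ncard_le_ncard hsub hfin


end Summit.QuantumAdvantage.QuantumAdvantage.Theorems.DegreeOnePrimesEscape

end
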